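import Mathlib
import Summits.NavierStokesRegularity.NavierStokesRegularity.Theorems.TaoLadderRungTwoFlatTruncatedDeviation
import HarnessLib

/-!
# The interface input of the two-zone loop in terms of the behind energy and the core radius (junk race, entries
  `m₂₁` / `m₂₂` of theory-1's 2×2 loop) (helper for stmt-NavierStokesRegularity-23909 `GradedAdiabaticWake` /
  stmt-…-23908; route TaoLadderRungTwoFlat; cell harvest/h2-tao-ladder, p1 g21; JUNK-RACE-49 §49.5 (b), HOP-INVARIANT-50 (K3))

`…TruncatedDeviation` gives the interface forcing `f = interfaceForcing ε ε₀ e W u` of the core-truncated deviation and its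
first-order bounds; `…CoMovingEnergy.sq_le_exp_mul_coMovingEnergyOn` controls the behind deviation at the edge shell by
the co-moving energy `V` of a block containing `e`. This file composes them into the two numbers the loop consumes:

* `abs_interfaceForcing_carrier_le_of_energy` — with `|V_e| ≤ η̂`, `|A_{e+1}| ≤ η̂`, `|p_{e+1}| ≤ r` and `e` in the
  behind block `s` with edge `n_e`:  `|f₀,ₑ₊₁| ≤ c_e·q·(2η̂ + q + ε(η̂ + r))`, `q := √(2e^{θ(n_e−e)}·V_s)` — the
  near → core entry, `O(√V)` with a coefficient first order in `η̂` (plus the quadratic `q²`);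
* `abs_interfaceForcing_bond_le_of_radius` — `|f₁,ₑ| ≤ c_e·r·(η̂ + ε(2η̂ + r))` — a core self-term, first order in `η̂`.
In the contraction gauge these are multiplied by `ω_{e+1} = b^{−K}` resp. `ω_e = b^{−K−1}` (`…TruncatedHopTwoGauge`).

HONEST FRAMING: elementary inequalities about a MODEL lattice (Tao 2016 §4 vocabulary on `S♭`); nothing certified;
nothing about the Navier–Stokes equations.
-/

noncomputable section

-- the sub-problem namespace repeats the summit name by design (D-0017)
set_option linter.dupNamespace false

namespace Summit.NavierStokesRegularity.NavierStokesRegularity.Theorems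

open Literature.Analysis.FluidPDE Literature.Analysis.FluidPDE.TaoCascade

namespace MirrorPulse

/-- **Near → core entry.** See the module docstring. [cite: Tao2016AveragedNS, §4 (4.8); route TaoLadderRungTwoFlat, L8b-2/L8b-3 (JUNK-RACE-49 §49.5 (b))] -/
theorem abs_interfaceForcing_carrier_le_of_energy {ε ε₀ θ ne ηhat r : ℝ} (hε : 0 ≤ ε) (hε₀ : -1 ≤ ε₀)
    {e : ℤ} (W u : Fin 2 → ℤ → ℝ → ℝ) (t : ℝ) (s : Finset ℤ) (he : e ∈ s)
    (hVe : |W 1 e t| ≤ ηhat) (hAe : |W 0 (e + 1) t| ≤ ηhat) (hr : |u 0 (e + 1) t| ≤ r) :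
    |interfaceForcing ε ε₀ e W u 0 (e + 1) t|
      ≤ clock ε₀ e * Real.sqrt (2 * (Real.exp (θ * (ne - (e : ℝ))) * coMovingEnergyOn s θ ne u t)) *
          (2 * ηhat + Real.sqrt (2 * (Real.exp (θ * (ne - (e : ℝ))) * coMovingEnergyOn s θ ne u t))
            + ε * (ηhat + r)) := by
  set q := Real.sqrt (2 * (Real.exp (θ * (ne - (e : ℝ))) * coMovingEnergyOn s θ ne u t)) with hq
  have hqe : |u 1 e t| ≤ q := abs_behind_le_of_coMovingEnergyOn s θ ne u t he 1
  have hq0 : 0 ≤ q := Real.sqrt_nonneg _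
  have hc : 0 ≤ clock ε₀ e := by unfold clock; exact Real.rpow_nonneg (by linarith) _
  have h := abs_interfaceForcing_carrier_le hε hε₀ e W u t
  have hr0 : 0 ≤ r := (abs_nonneg _).trans hr
  have h2 : 2 * |W 1 e t| + |u 1 e t| + ε * (|W 0 (e + 1) t| + |u 0 (e + 1) t|)
      ≤ 2 * ηhat + q + ε * (ηhat + r) := by
    have := mul_le_mul_of_nonneg_left (add_le_add hAe hr) hε
    linarith
  have h3 : 0 ≤ 2 * |W 1 e t| + |u 1 e t| + ε * (|W 0 (e + 1) t| + |u 0 (e + 1) t|) := by positivity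
  calc |interfaceForcing ε ε₀ e W u 0 (e + 1) t|
      ≤ clock ε₀ e * |u 1 e t| * (2 * |W 1 e t| + |u 1 e t| + ε * (|W 0 (e + 1) t| + |u 0 (e + 1) t|)) := h
    _ ≤ clock ε₀ e * q * (2 * ηhat + q + ε * (ηhat + r)) := by
        apply mul_le_mul (mul_le_mul_of_nonneg_left hqe hc) h2 h3 (mul_nonneg hc hq0)

/-- **Core self-term at the interface.** See the module docstring. [cite: Tao2016AveragedNS, §4 (4.8); route TaoLadderRungTwoFlat, L8b-3 (JUNK-RACE-49 §49.5 (b))] -/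
theorem abs_interfaceForcing_bond_le_of_radius {ε ε₀ ηhat r : ℝ} (hε : 0 ≤ ε) (hε₀ : -1 ≤ ε₀)
    (e : ℤ) (W u : Fin 2 → ℤ → ℝ → ℝ) (t : ℝ) (hVe : |W 1 e t| ≤ ηhat) (hAe : |W 0 (e + 1) t| ≤ ηhat)
    (hr : |u 0 (e + 1) t| ≤ r) :
    |interfaceForcing ε ε₀ e W u 1 e t| ≤ clock ε₀ e * r * (ηhat + ε * (2 * ηhat + r)) := by
  have hc : 0 ≤ clock ε₀ e := by unfold clock; exact Real.rpow_nonneg (by linarith) _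
  have h := abs_interfaceForcing_bond_le hε hε₀ e W u t
  have hr0 : 0 ≤ r := (abs_nonneg _).trans hr
  have h2 : |W 1 e t| + ε * (2 * |W 0 (e + 1) t| + |u 0 (e + 1) t|) ≤ ηhat + ε * (2 * ηhat + r) := by
    have : 2 * |W 0 (e + 1) t| + |u 0 (e + 1) t| ≤ 2 * ηhat + r := by linarith
    have := mul_le_mul_of_nonneg_left this hε
    linarith
  have h3 : 0 ≤ |W 1 e t| + ε * (2 * |W 0 (e + 1) t| + |u 0 (e + 1) t|) := by positivity
  calc |interfaceForcing ε ε₀ e W u 1 e t|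
      ≤ clock ε₀ e * |u 0 (e + 1) t| * (|W 1 e t| + ε * (2 * |W 0 (e + 1) t| + |u 0 (e + 1) t|)) := h
    _ ≤ clock ε₀ e * r * (ηhat + ε * (2 * ηhat + r)) := by
        apply mul_le_mul (mul_le_mul_of_nonneg_left hr hc) h2 h3 (mul_nonneg hc hr0)

end MirrorPulse

end Summit.NavierStokesRegularity.NavierStokesRegularity.Theorems

end
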